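import Literature.NumberTheory.EllipticCurves.ZpExtensionGaloisTwistLocal
import Literature.NumberTheory.EllipticCurves.GreenbergVatsal2000.GreenbergSelmerGroups
import Literature.NumberTheory.EllipticCurves.SubgroupSelmerCocycleCriteriaProofs
import Summits.BirchSwinnertonDyer.Rank1Residual.X11b.MaxUnramifiedRestriction
import HarnessLib

/-!
# T-42-mult in the kernel, XX: classes lifted from `H¹(Γ_K, E[p^J](χ_u))` are UNRAMIFIED over `K_∞`
# wherever they are unramified at level `K` — the `c′ ∈ H¹(K_Σ/K_∞, E[p^∞])` clause of `LIFT₁`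

Cell `bsd-2adic` (run/shared/lean/pub/bsd-2adic/), seat `bsd-2adic-t42` (BRIEF-T42), GEN 15. HONEST FRAMING:
research route; THEOREMS ONLY (no `def`, no named fact, no instance); nothing booked; nothing re-keyed
(RC-169); BSD is not proved by any of this. PARTITION: X5@2 multiplicative GV-transport rows (K4ᵐ B1·O1; the
residual `LIFT₁` of `hF3b`, file XIX `…TwistedDescentSingle.lean`) × p = 2 — types-the-object-of; bears_on
K4 items 19922 / 19923 (`--supports stmt-BirchSwinnertonDyer-19923`). Brick (N1) of
HOME/t42/DESIGN-T42-ADDENDUM-16.md.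

## What

In the generic lifting `LIFT₁` the lifted class `c′` must lie in
`H = unramifiedOutside (ker κ) E[p^∞] p S₀ = H¹(K_Σ/K_∞, E[p^∞])` (Greenberg–Vatsal's `H¹(ℚ_Σ/ℚ_∞, A)`).
When `c′ = twistedTorsionToH1 x` comes from a class `x ∈ H¹(Γ_K, E[p^J](χ_u))` (files
`ZpExtensionGaloisTwistRestrict/Local`), this follows from the LEVEL-`K` condition «`x` is unramified at
`v`» of the Poitou–Tate Selmer structure (`DiscreteGaloisModule.unramifiedSubgroup` of
`GaloisRepresentations/BlochKatoSelmerGroup.lean`, the local condition of `SelmerStructure.IsUnramifiedOutside`):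

* §1 `twistedTorsionToH1_mem_unramifiedKer` — at ANY finite place `v`: if
  `loc_v x ∈ H¹_ur(K_v, E[p^J](χ_u))` then `c′ ∈ unramifiedKer (ker κ) E[p^∞] v` (the cocycle of `x` is
  principal on `I_{K_v}` — X11b `LocBridge.mem_unramifiedSubgroup_one_iff_exists`, i.e.
  `I_{K_v} = range (Γ_{K_v^{nr}} → Γ_{K_v})` —, `I_v = res(I_{K_v})` (`GreenbergSelmer.inertia`), and the
  twist is trivial on `ker κ ⊓ I_v`; no hypothesis `I_v ≤ ker κ` is needed because `unramifiedKer`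
  restricts to `ker κ ⊓ I_v`);
* §2 `twistedTorsionToH1_mem_unramifiedOutside` — hence, if `x` is unramified at every finite `v ∉ S₀`,
  `v ∤ p`, then `c′ ∈ unramifiedOutside (ker κ) E[p^∞] p S₀`: the conditions at the CONJUGATE places hold
  because `c′` is an eigenclass of every `conj_σ` (`conjH1_twistedTorsionToH1_mem`, file
  `ZpExtensionGaloisTwistRestrict`).

References: [GreenbergLNM1716] §4 pp. 107, 124; [GreenbergVatsal2000] §2 pp. 16–17 («`[σ|_{I_η}] = 0`»);
[MilneADT2006] I §2 (unramified cohomology); [Washington1997] Prop. 13.2.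
-/

set_option autoImplicit false
set_option linter.dupNamespace false

noncomputable section

open scoped Classical

universe u

namespace Summit.BirchSwinnertonDyer.BirchSwinnertonDyer.Theorems.MultTransportTwistedDescent

open NumberField IsDedekindDomain Field WeierstrassCurve CategoryTheory
  Literature.NumberTheory.EllipticCurves Literature.NumberTheory.EllipticCurves.GreenbergVatsal2000
  Literature.NumberTheory.EllipticCurves.GreenbergSelmer Literature.NumberTheory.GaloisRepresentations
  Literature.NumberTheory.GaloisRepresentations.IsNonarchimedeanLocalField
  Summit.BirchSwinnertonDyer.Rank1Residual.X11b

variable {K : Type u} [Field K] [NumberField K] (W : WeierstrassCurve K) (p : ℕ) [Fact p.Prime]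
  (κ : ZpExtension K p) (J : ℕ) (u : ℤ) (hu : (p : ℤ) ∣ u - 1)

/-! ## §1. Unramified at `v` at level `K` ⟹ unramified at the chosen place of `K_∞` above `v` -/

/-- **`c′ = twistedTorsionToH1 x` is unramified at the chosen place above `v` when `x` is unramified at
`v`** (any finite `v`). The cocycle `ξ` of `x` restricted to `Γ_{K_v}` is principal on the inertia group
`I_{K_v}` (`LocBridge.mem_unramifiedSubgroup_one_iff_exists`): `ξ(τ|_{K̄}) = τ⋆w − w`; on
`ker κ ⊓ I_v` (`I_v = res(I_{K_v})`) the twisted action `⋆` is the plain one, so the cocycle of `c′` is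
principal on `ker κ ⊓ I_v` (`CocycleCriteria.resH1Hom_oneCocycleClass_eq_zero_iff`).
[cite: GreenbergVatsal2000, §2 p. 17] [cite: MilneADT2006, Ch. I §2] -/
theorem twistedTorsionToH1_mem_unramifiedKer (v : HeightOneSpectrum (𝓞 K))
    (x : galoisCohomology (W.twistedTorsionGaloisModule p κ J u hu) 1)
    (hx : galoisCohomology.res (W.twistedTorsionGaloisModule p κ J u hu) (v.adicCompletion K) 1 x ∈
      DiscreteGaloisModule.unramifiedSubgroup
        ((W.twistedTorsionGaloisModule p κ J u hu).restrictField (v.adicCompletion K)) 1) :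
    W.twistedTorsionToH1 p κ J u hu x ∈
      GreenbergVatsal2000.unramifiedKer κ.kerSubgroup (W.geomPrimaryTorsion p) v := by
  obtain ⟨ξ, rfl⟩ := oneCocycleClass_surjective _ x
  rw [galoisCohomology.res_oneCocycleClass] at hx
  obtain ⟨w, hw⟩ := (LocBridge.mem_unramifiedSubgroup_one_iff_exists _ _).mp hx
  rw [twistedTorsionToH1_oneCocycleClass, GreenbergVatsal2000.unramifiedKer, AddMonoidHom.mem_ker,
    CocycleCriteria.resH1Hom_oneCocycleClass_eq_zero_iff]
  refine ⟨AddSubgroup.inclusion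
      (Literature.Barriers.BirchSwinnertonDyer.geomTorsion_pow_le_geomPrimaryTorsion W p J) w,
    fun y ↦ ?_⟩
  -- `(y : Γ_K) = res τ` with `τ ∈ I_{K_v}`, and `(y : Γ_K) ∈ ker κ`
  obtain ⟨hyker, hyI⟩ := (mem_inertiaIn_iff κ.kerSubgroup v y).mp y.2
  obtain ⟨τ, hτI, hτ⟩ := Subgroup.mem_map.mp hyI
  have hτy : absGaloisRestrict K (v.adicCompletion K) τ =
      ((y : decomp (K := K) v) : absoluteGaloisGroup K) := hτ
  have hwτ := hw τ hτI
  rw [galoisCohomology.pullback_absGaloisRestrict_apply] at hwτ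
  -- the twisted action of `res τ = y ∈ ker κ` is the plain one
  have hact : ((W.twistedTorsionGaloisModule p κ J u hu).restrictField (v.adicCompletion K)) τ w =
      ((y : decomp (K := K) v) : absoluteGaloisGroup K) • w := by
    change W.twistedTorsionGaloisModule p κ J u hu (absGaloisRestrict K (v.adicCompletion K) τ) w = _
    rw [hτy, ZpExtension.galoisTwist_apply_of_mem_kerSubgroup _ _ _ _ _ _ hyker,
      torsionGaloisModule_apply_apply]
  rw [hact, hτy] at hwτ
  -- evaluate the pushed/restricted cocycle at `y`
  have hyeq : ((inertiaInToH κ.kerSubgroup v y : κ.kerSubgroup) : absoluteGaloisGroup K) =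
      ((y : decomp (K := K) v) : absoluteGaloisGroup K) := rfl
  change AddMonoidHom.id _ ((contOneCocycles.push _ _ _).1 (inertiaInToH κ.kerSubgroup v y)) = _
  rw [AddMonoidHom.id_apply, contOneCocycles.push_apply, ZpExtension.pullback_galoisTwistResHom_apply,
    hyeq, hwτ, map_sub]
  rfl

/-! ## §2. The `H¹(K_Σ/K_∞, E[p^∞])` clause of `LIFT₁` -/

/-- **`c′ = twistedTorsionToH1 x ∈ H¹(K_Σ/K_∞, E[p^∞]) = unramifiedOutside (ker κ) E[p^∞] p S₀` when `x`
is unramified at every finite `v ∉ S₀`, `v ∤ p`** (the local conditions of the level-`K` Selmer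
structure outside `S = S₀ ∪ {v ∣ p} ∪ ∞`). At the chosen place above `v` this is §1; at the conjugate
places it follows because `c′` is an eigenclass of every `conj_σ` (`conjH1_twistedTorsionToH1_mem`).
(For `v ∤ p` one has `I_v ≤ ker κ` — `ZpExtension.inertia_le_kerSubgroup_holds` — so `ker κ ⊓ I_v = I_v`
and the condition is GV's `[σ|_{I_η}] = 0`.)
[cite: GreenbergLNM1716, §4 pp. 107, 124] [cite: GreenbergVatsal2000, §2 pp. 16–17] -/
theorem twistedTorsionToH1_mem_unramifiedOutside (S₀ : Set (HeightOneSpectrum (𝓞 K)))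
    (x : galoisCohomology (W.twistedTorsionGaloisModule p κ J u hu) 1)
    (hx : ∀ v : HeightOneSpectrum (𝓞 K), v ∉ S₀ → ((p : ℕ) : 𝓞 K) ∉ v.asIdeal →
      galoisCohomology.res (W.twistedTorsionGaloisModule p κ J u hu) (v.adicCompletion K) 1 x ∈
        DiscreteGaloisModule.unramifiedSubgroup
          ((W.twistedTorsionGaloisModule p κ J u hu).restrictField (v.adicCompletion K)) 1) :
    W.twistedTorsionToH1 p κ J u hu x ∈
      unramifiedOutside κ.kerSubgroup (W.geomPrimaryTorsion p) p S₀ := by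
  rw [mem_unramifiedOutside_iff]
  intro v hvS hpv σ
  exact W.conjH1_twistedTorsionToH1_mem p κ J u hu _ x
    (twistedTorsionToH1_mem_unramifiedKer W p κ J u hu v x (hx v hvS hpv)) σ

end Summit.BirchSwinnertonDyer.BirchSwinnertonDyer.Theorems.MultTransportTwistedDescent

end
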